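import Mathlib
import HarnessLib
import Literature.Analysis.FluidPDE.Tao2016AveragedNS.TaylorChainCertificate

/-!
# Line `taylor-model` on crux K1b-DR (stmt-NavierStokesRegularity-23954) — readout stub G, helper 0b:
# window coordinates and bilinearity of the polarised truncated cascade field

Helper file toward the registered stub `stub_readout : TaylorModelReadout` (S1 → K → K1b-DR; line
`taylor-model`, ideator ns-idea-2 g3, skeleton v3 `9391589be9c875b2`). The abstract soundness S1 lives on
`Fin n → ℝ`; the certificate `d : TaylorChain.CertData` (Literature, p593471) and the crux K1b-DR live on
shell states `Fin 4 → ℤ → ℝ` truncated to the window `[-Kb, Ka]`. This file supplies the dictionary: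

* `trunc` (zero off the window) and the bilinear polarised field: `qB d u v` is the explicit bilinear
  form whose diagonal is the truncated field, `qT_eq_qB : d.qT y = qB d y y`, and
  `Qb_eq : d.Qb u v = ½ (qB d u v + qB d v u)`; hence `d.Qb` is additive and homogeneous in each slot
  (`Qb_add_left/right`, `Qb_smul_left/right`) and window-supported (`wsupp_Qb`) — S1's `IsLinearMap`
  hypotheses are NOT clauses of the certificate, they are proved here from the shape of `quadTerm`;
* window coordinates: `nW d` = number of window coordinates, `toVec d : (Fin 4 → ℤ → ℝ) → (Fin (nW d) → ℝ)`
  (restriction) and `ofVec d` (zero extension), inverse to each other on window-supported states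
  (`toVec_ofVec`, `ofVec_toVec`), linear; the weighted balls `d.InBall j` read coordinatewise
  (`inBall_iff_toVec`); the transported field `Qw d u v := toVec d (d.Qb (ofVec d u) (ofVec d v))`
  is bilinear (`isLinearMap_Qw_left/right`) and inherits the certificate's weighted bound (B)
  (`Qw_weighted_bound`), i.e. exactly the field hypotheses of `TaylorModelSoundness` with `n = nW d`,
  `w c = d.ω j (shell of c)`, `b = d.bb j`.

MODEL-lattice bookkeeping only (rung TL-M3); nothing here is a statement about the Navier–Stokes equations.
-/

noncomputable section

-- the sub-problem namespace repeats the summit name by design (D-0017)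
set_option linter.dupNamespace false

namespace Summit.NavierStokesRegularity.NavierStokesRegularity.Theorems.TaylorModelReadout

open scoped BigOperators
open Finset Literature.Analysis.FluidPDE.TaoCascade Literature.Analysis.FluidPDE.TaoCascade.TaylorChain

variable (d : CertData)

/-! ### Truncation to the window and the bilinear polarisation -/

/-- Truncation of a shell state to the window `[-Kb, Ka]` (zero off it). [folklore] -/
def trunc (y : Fin 4 → ℤ → ℝ) : Fin 4 → ℤ → ℝ :=
  fun j n => if -d.Kb ≤ n ∧ n ≤ d.Ka then y j n else 0

/-- Unfolding `trunc`. [folklore] -/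
@[simp] theorem trunc_apply (y : Fin 4 → ℤ → ℝ) (j : Fin 4) (n : ℤ) :
    trunc d y j n = if -d.Kb ≤ n ∧ n ≤ d.Ka then y j n else 0 := rfl

/-- `trunc` is additive. [folklore] -/
theorem trunc_add (u v : Fin 4 → ℤ → ℝ) : trunc d (u + v) = trunc d u + trunc d v := by
  funext j n
  by_cases h : -d.Kb ≤ n ∧ n ≤ d.Ka <;> simp [trunc, h]

/-- `trunc` is homogeneous. [folklore] -/
theorem trunc_smul (r : ℝ) (u : Fin 4 → ℤ → ℝ) : trunc d (r • u) = r • trunc d u := by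
  funext j n
  by_cases h : -d.Kb ≤ n ∧ n ≤ d.Ka <;> simp [trunc, h]

/-- A window-supported state is its own truncation. [folklore] -/
theorem trunc_eq_self {y : Fin 4 → ℤ → ℝ} (hy : d.Wsupp y) : trunc d y = y := by
  funext j n
  by_cases h : -d.Kb ≤ n ∧ n ≤ d.Ka
  · simp [trunc, h]
  · simp [trunc, h, hy j n h]

/-- Truncations are window-supported. [folklore] -/
theorem wsupp_trunc (y : Fin 4 → ℤ → ℝ) : d.Wsupp (trunc d y) := fun j n h => by
  simp [trunc, h]

/-- The explicit BILINEAR form of the window-truncated cascade field (Tao's `quadTerm` at `ε₀ = 1`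
with the two state slots separated and truncated). [cite: Tao2016AveragedNS, §4 (4.8)] -/
def qB (u v : Fin 4 → ℤ → ℝ) (i : Fin 4) (k : ℤ) : ℝ :=
  if -d.Kb ≤ k ∧ k ≤ d.Ka then
    ∑ i₁ : Fin 4, ∑ i₂ : Fin 4, ∑ μ ∈ shiftSet,
      d.α i₁ i₂ i μ * (1 + 1 : ℝ) ^ ((5 : ℝ) * (k - μ.2.2) / 2) *
        (trunc d u i₁ (k - μ.2.2 + μ.1) * trunc d v i₂ (k - μ.2.2 + μ.2.1))
  else 0

/-- The truncated field is the diagonal of `qB`. [folklore] -/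
theorem qT_eq_qB (y : Fin 4 → ℤ → ℝ) (i : Fin 4) (k : ℤ) : d.qT y i k = qB d y y i k := by
  unfold CertData.qT qB
  by_cases hk : -d.Kb ≤ k ∧ k ≤ d.Ka
  · simp only [hk, and_self, ↓reduceIte, quadTerm, trunc_apply]
  · simp [hk]

/-- `qB` is additive in the first slot. [folklore] -/
theorem qB_add_left (u u' v : Fin 4 → ℤ → ℝ) (i : Fin 4) (k : ℤ) :
    qB d (u + u') v i k = qB d u v i k + qB d u' v i k := by
  unfold qB
  by_cases hk : -d.Kb ≤ k ∧ k ≤ d.Ka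
  · simp only [hk, and_self, ↓reduceIte, trunc_add, Pi.add_apply, ← sum_add_distrib]
    refine sum_congr rfl fun i₁ _ => sum_congr rfl fun i₂ _ => sum_congr rfl fun μ _ => ?_
    ring
  · simp [hk]

/-- `qB` is additive in the second slot. [folklore] -/
theorem qB_add_right (u v v' : Fin 4 → ℤ → ℝ) (i : Fin 4) (k : ℤ) :
    qB d u (v + v') i k = qB d u v i k + qB d u v' i k := by
  unfold qB
  by_cases hk : -d.Kb ≤ k ∧ k ≤ d.Ka
  · simp only [hk, and_self, ↓reduceIte, trunc_add, Pi.add_apply, ← sum_add_distrib]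
    refine sum_congr rfl fun i₁ _ => sum_congr rfl fun i₂ _ => sum_congr rfl fun μ _ => ?_
    ring
  · simp [hk]

/-- `qB` is homogeneous in the first slot. [folklore] -/
theorem qB_smul_left (r : ℝ) (u v : Fin 4 → ℤ → ℝ) (i : Fin 4) (k : ℤ) :
    qB d (r • u) v i k = r * qB d u v i k := by
  unfold qB
  by_cases hk : -d.Kb ≤ k ∧ k ≤ d.Ka
  · simp only [hk, and_self, ↓reduceIte, trunc_smul, Pi.smul_apply, smul_eq_mul, mul_sum]
    refine sum_congr rfl fun i₁ _ => sum_congr rfl fun i₂ _ => sum_congr rfl fun μ _ => ?_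
    ring
  · simp [hk]

/-- `qB` is homogeneous in the second slot. [folklore] -/
theorem qB_smul_right (r : ℝ) (u v : Fin 4 → ℤ → ℝ) (i : Fin 4) (k : ℤ) :
    qB d u (r • v) i k = r * qB d u v i k := by
  unfold qB
  by_cases hk : -d.Kb ≤ k ∧ k ≤ d.Ka
  · simp only [hk, and_self, ↓reduceIte, trunc_smul, Pi.smul_apply, smul_eq_mul, mul_sum]
    refine sum_congr rfl fun i₁ _ => sum_congr rfl fun i₂ _ => sum_congr rfl fun μ _ => ?_
    ring
  · simp [hk]

/-- **Polarisation identity**: `d.Qb u v = ½ (qB u v + qB v u)`. [folklore] -/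
theorem Qb_eq (u v : Fin 4 → ℤ → ℝ) (i : Fin 4) (k : ℤ) :
    d.Qb u v i k = (qB d u v i k + qB d v u i k) / 2 := by
  simp only [CertData.Qb, qT_eq_qB, qB_add_left, qB_add_right]
  ring

/-- `d.Qb` is additive in the first slot. [folklore] -/
theorem Qb_add_left (u u' v : Fin 4 → ℤ → ℝ) : d.Qb (u + u') v = d.Qb u v + d.Qb u' v := by
  funext i k
  simp only [Pi.add_apply, Qb_eq, qB_add_left, qB_add_right]
  ring

/-- `d.Qb` is additive in the second slot. [folklore] -/
theorem Qb_add_right (u v v' : Fin 4 → ℤ → ℝ) : d.Qb u (v + v') = d.Qb u v + d.Qb u v' := by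
  funext i k
  simp only [Pi.add_apply, Qb_eq, qB_add_left, qB_add_right]
  ring

/-- `d.Qb` is homogeneous in the first slot. [folklore] -/
theorem Qb_smul_left (r : ℝ) (u v : Fin 4 → ℤ → ℝ) : d.Qb (r • u) v = r • d.Qb u v := by
  funext i k
  simp only [Pi.smul_apply, smul_eq_mul, Qb_eq, qB_smul_left, qB_smul_right]
  ring

/-- `d.Qb` is homogeneous in the second slot. [folklore] -/
theorem Qb_smul_right (r : ℝ) (u v : Fin 4 → ℤ → ℝ) : d.Qb u (r • v) = r • d.Qb u v := by
  funext i k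
  simp only [Pi.smul_apply, smul_eq_mul, Qb_eq, qB_smul_left, qB_smul_right]
  ring

/-- `d.Qb u u` is the truncated field itself. [folklore] -/
theorem Qb_self (u : Fin 4 → ℤ → ℝ) : d.Qb u u = d.qT u := by
  funext i k
  rw [Qb_eq, qT_eq_qB]
  ring

/-- The polarised field is window-supported. [folklore] -/
theorem wsupp_Qb (u v : Fin 4 → ℤ → ℝ) : d.Wsupp (d.Qb u v) := fun i k hk => by
  simp [Qb_eq, qB, hk]

/-- The polarised field only sees the window coordinates of its arguments. [folklore] -/
theorem Qb_trunc (u v : Fin 4 → ℤ → ℝ) : d.Qb (trunc d u) (trunc d v) = d.Qb u v := by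
  funext i k
  have ht : ∀ y : Fin 4 → ℤ → ℝ, trunc d (trunc d y) = trunc d y :=
    fun y => trunc_eq_self d (wsupp_trunc d y)
  simp only [Qb_eq, qB, ht]

/-! ### Window coordinates -/

/-- The window index set `Fin 4 × [-Kb, Ka]`. [folklore] -/
abbrev WinIdx : Type := Fin 4 × ↥(Finset.Icc (-d.Kb) d.Ka)

/-- Number of window coordinates (`= 4 (Ka + Kb + 1)` when `-Kb ≤ Ka`). [folklore] -/
def nW : ℕ := Fintype.card (WinIdx d)

/-- A fixed enumeration of the window coordinates. [folklore] -/
def eW : WinIdx d ≃ Fin (nW d) := Fintype.equivFin (WinIdx d)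

/-- The shell index of a window coordinate. [folklore] -/
def shellOf (c : Fin (nW d)) : ℤ := (((eW d).symm c).2 : ℤ)

/-- The mode index of a window coordinate. [folklore] -/
def modeOf (c : Fin (nW d)) : Fin 4 := ((eW d).symm c).1

/-- The shell of a window coordinate lies in the window. [folklore] -/
theorem shellOf_mem (c : Fin (nW d)) : -d.Kb ≤ shellOf d c ∧ shellOf d c ≤ d.Ka :=
  Finset.mem_Icc.1 ((eW d).symm c).2.2

/-- Restriction of a shell state to the window coordinates. [folklore] -/
def toVec (y : Fin 4 → ℤ → ℝ) : Fin (nW d) → ℝ := fun c => y (modeOf d c) (shellOf d c)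

/-- Zero extension of window coordinates to a shell state. [folklore] -/
def ofVec (x : Fin (nW d) → ℝ) : Fin 4 → ℤ → ℝ :=
  fun i k => if h : -d.Kb ≤ k ∧ k ≤ d.Ka then x (eW d (i, ⟨k, Finset.mem_Icc.2 h⟩)) else 0

/-- `ofVec` on a window shell is the corresponding coordinate. [folklore] -/
theorem ofVec_apply_of_mem (x : Fin (nW d) → ℝ) (i : Fin 4) {k : ℤ} (h : -d.Kb ≤ k ∧ k ≤ d.Ka) :
    ofVec d x i k = x (eW d (i, ⟨k, Finset.mem_Icc.2 h⟩)) := by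
  simp [ofVec, h]

/-- `ofVec` vanishes off the window. [folklore] -/
theorem ofVec_apply_of_not_mem (x : Fin (nW d) → ℝ) (i : Fin 4) {k : ℤ} (h : ¬(-d.Kb ≤ k ∧ k ≤ d.Ka)) :
    ofVec d x i k = 0 := by
  simp [ofVec, h]

/-- Zero extensions are window-supported. [folklore] -/
theorem wsupp_ofVec (x : Fin (nW d) → ℝ) : d.Wsupp (ofVec d x) := fun i _ h =>
  ofVec_apply_of_not_mem d x i h

/-- `toVec ∘ ofVec = id`. [folklore] -/
@[simp] theorem toVec_ofVec (x : Fin (nW d) → ℝ) : toVec d (ofVec d x) = x := by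
  funext c
  simp only [toVec]
  rw [ofVec_apply_of_mem d x _ (shellOf_mem d c)]
  congr 1
  have : ((modeOf d c, ⟨shellOf d c, Finset.mem_Icc.2 (shellOf_mem d c)⟩) : WinIdx d) = (eW d).symm c := by
    rfl
  rw [this, Equiv.apply_symm_apply]

/-- `ofVec ∘ toVec = trunc`. [folklore] -/
theorem ofVec_toVec (y : Fin 4 → ℤ → ℝ) : ofVec d (toVec d y) = trunc d y := by
  funext i k
  by_cases h : -d.Kb ≤ k ∧ k ≤ d.Ka
  · rw [ofVec_apply_of_mem d _ i h]
    simp only [toVec, modeOf, shellOf, Equiv.symm_apply_apply, trunc_apply, h, and_self, ↓reduceIte]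
  · rw [ofVec_apply_of_not_mem d _ i h]
    simp [h]

/-- On window-supported states `ofVec ∘ toVec = id`. [folklore] -/
theorem ofVec_toVec_of_wsupp {y : Fin 4 → ℤ → ℝ} (hy : d.Wsupp y) : ofVec d (toVec d y) = y := by
  rw [ofVec_toVec, trunc_eq_self d hy]

/-- `toVec` only sees the window. [folklore] -/
@[simp] theorem toVec_trunc (y : Fin 4 → ℤ → ℝ) : toVec d (trunc d y) = toVec d y := by
  funext c
  simp [toVec, shellOf_mem d c]

/-- `toVec` is additive. [folklore] -/
@[simp] theorem toVec_add (u v : Fin 4 → ℤ → ℝ) : toVec d (u + v) = toVec d u + toVec d v := rfl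
/-- `toVec` is homogeneous. [folklore] -/
@[simp] theorem toVec_smul (r : ℝ) (u : Fin 4 → ℤ → ℝ) : toVec d (r • u) = r • toVec d u := rfl
/-- `toVec` respects subtraction. [folklore] -/
@[simp] theorem toVec_sub (u v : Fin 4 → ℤ → ℝ) : toVec d (u - v) = toVec d u - toVec d v := rfl
/-- `toVec 0 = 0`. [folklore] -/
@[simp] theorem toVec_zero : toVec d 0 = 0 := rfl

/-- `ofVec` is additive. [folklore] -/
@[simp] theorem ofVec_add (x x' : Fin (nW d) → ℝ) : ofVec d (x + x') = ofVec d x + ofVec d x' := by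
  funext i k
  by_cases h : -d.Kb ≤ k ∧ k ≤ d.Ka <;> simp [ofVec, h]

/-- `ofVec` is homogeneous. [folklore] -/
@[simp] theorem ofVec_smul (r : ℝ) (x : Fin (nW d) → ℝ) : ofVec d (r • x) = r • ofVec d x := by
  funext i k
  by_cases h : -d.Kb ≤ k ∧ k ≤ d.Ka <;> simp [ofVec, h]

/-- `ofVec 0 = 0`. [folklore] -/
@[simp] theorem ofVec_zero : ofVec d 0 = 0 := by
  funext i k
  by_cases h : -d.Kb ≤ k ∧ k ≤ d.Ka <;> simp [ofVec, h]

/-- `ofVec` respects subtraction. [folklore] -/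
theorem ofVec_sub (x x' : Fin (nW d) → ℝ) : ofVec d (x - x') = ofVec d x - ofVec d x' := by
  rw [sub_eq_add_neg, ← neg_one_smul ℝ x', ofVec_add, ofVec_smul, neg_one_smul, ← sub_eq_add_neg]

/-- Two window-supported states with the same window coordinates are equal. [folklore] -/
theorem eq_of_toVec_eq {y y' : Fin 4 → ℤ → ℝ} (hy : d.Wsupp y) (hy' : d.Wsupp y')
    (h : toVec d y = toVec d y') : y = y' := by
  rw [← ofVec_toVec_of_wsupp d hy, ← ofVec_toVec_of_wsupp d hy', h]

/-! ### Weighted balls and the transported field -/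

/-- Weight of a window coordinate at stage `j`. [folklore] -/
def wW (j : ℕ) (c : Fin (nW d)) : ℝ := d.ω j (shellOf d c)

/-- The coordinate weights are positive when the certificate's weights are. [folklore] -/
theorem wW_pos {j : ℕ} (hω : ∀ k, 0 < d.ω j k) (c : Fin (nW d)) : 0 < wW d j c := hω _

/-- `d.InBall j y N` read on the window coordinates. [folklore] -/
theorem inBall_iff_toVec (j : ℕ) (y : Fin 4 → ℤ → ℝ) (N : ℝ) :
    d.InBall j y N ↔ ∀ c, |toVec d y c| ≤ N * wW d j c := by
  constructor
  · intro h c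
    exact h (modeOf d c) (shellOf d c) (shellOf_mem d c).1 (shellOf_mem d c).2
  · intro h i k hk1 hk2
    have hc := h (eW d (i, ⟨k, Finset.mem_Icc.2 ⟨hk1, hk2⟩⟩))
    simpa [toVec, wW, modeOf, shellOf] using hc

/-- The window ball of a zero extension. [folklore] -/
theorem inBall_ofVec_iff (j : ℕ) (x : Fin (nW d) → ℝ) (N : ℝ) :
    d.InBall j (ofVec d x) N ↔ ∀ c, |x c| ≤ N * wW d j c := by
  rw [inBall_iff_toVec, toVec_ofVec]

/-- The polarised truncated field transported to window coordinates. [folklore] -/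
def Qw (u v : Fin (nW d) → ℝ) : Fin (nW d) → ℝ := toVec d (d.Qb (ofVec d u) (ofVec d v))

/-- `ofVec ∘ Qw` is the polarised field of the zero extensions. [folklore] -/
theorem ofVec_Qw (u v : Fin (nW d) → ℝ) : ofVec d (Qw d u v) = d.Qb (ofVec d u) (ofVec d v) :=
  ofVec_toVec_of_wsupp d (wsupp_Qb d _ _)

/-- `Qw` is linear in the second slot. [folklore] -/
theorem isLinearMap_Qw_right (u : Fin (nW d) → ℝ) : IsLinearMap ℝ (Qw d u) := by
  constructor
  · intro v v'; simp [Qw, Qb_add_right]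
  · intro r v; simp [Qw, Qb_smul_right]

/-- `Qw` is linear in the first slot. [folklore] -/
theorem isLinearMap_Qw_left (v : Fin (nW d) → ℝ) : IsLinearMap ℝ (fun u => Qw d u v) := by
  constructor
  · intro u u'; simp [Qw, Qb_add_left]
  · intro r u; simp [Qw, Qb_smul_left]

/-- The certificate's weighted bilinear bound (B) transported to window coordinates — the field
hypothesis of `TaylorModelSoundness`. [folklore] -/
theorem Qw_weighted_bound {j : ℕ}
    (hB : ∀ (u v : Fin 4 → ℤ → ℝ) (Nu Nv : ℝ), 0 ≤ Nu → 0 ≤ Nv →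
      d.InBall j u Nu → d.InBall j v Nv → d.InBall j (d.Qb u v) (d.bb j * Nu * Nv))
    (u v : Fin (nW d) → ℝ) (Nu Nv : ℝ) (hNu : 0 ≤ Nu) (hNv : 0 ≤ Nv)
    (hu : ∀ c, |u c| ≤ Nu * wW d j c) (hv : ∀ c, |v c| ≤ Nv * wW d j c) :
    ∀ c, |Qw d u v c| ≤ d.bb j * Nu * Nv * wW d j c := by
  have h := hB (ofVec d u) (ofVec d v) Nu Nv hNu hNv ((inBall_ofVec_iff d j u Nu).2 hu)
    ((inBall_ofVec_iff d j v Nv).2 hv)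
  exact (inBall_iff_toVec d j _ _).1 h

end Summit.NavierStokesRegularity.NavierStokesRegularity.Theorems.TaylorModelReadout

end
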